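import Summits.BirchSwinnertonDyer.BirchSwinnertonDyer.Theorems.GenusKolyvaginAtTwoEquivariantKolyvaginExactAtTwoCebotarevVisibleRat
import HarnessLib

/-!
# Route `GenusKolyvaginAtTwo`, LINE 6 of crux `KolyvaginExactAtTwo` (22137), key child Q3′
# (stmt-BirchSwinnertonDyer-24882): McCallum's Prop. 3.1 in kernel form on TWO RAYS for the
# `ℚ`-pair `(E, E^{(d_K)})`, `ℚ_ℓ`-currency — the hypothesis `hCeb` of the visible pair EXACTNESS
# theorem (helper, PROVED; seat `bsd-line-gk2-p2` g11)

Sequel to `…CebotarevVisibleRat` (field `cebotarev`, p638752). The exactness theorem of the visible pair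
descent, `KolyvaginDescent.VisiblePairHypothesesM.sel₁_eq_and_card_sel₂_eq_of_primitive` (p634998),
takes Čebotarev a second time, in VISIBLE KERNEL FORM ON TWO RAYS (`hCeb`): for a finite set `T` of
pure classes of `V₁ × V₂ = H¹(ℚ, E[q]) × H¹(ℚ, E^{(d_K)}[q])` and two pure classes `g₁, g₂` such that
`rK₁ + rK₂` (restriction to `K(E[q])`) is injective on the span of `{g₁, g₂} ∪ T`, there are
Kolyvagin primes `ℓ > b` with `T ⊆ A₁ ℓ × A₂ ℓ` and, on the two rays,
`p^j g_k ∈ A₁ ℓ × A₂ ℓ ⟺ p^j g_k ∈ ⟨T⟩` (`k = 1, 2`). This lineage proved it in `K_λ`-currency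
(`GenusExact.exists_kolyvaginPrime_two_rays_of_not_isSquare`, p636164: basis of the span, the two-ray
character, the character form of Step B, the criterion); this file transports it to the `ℚ`-pair in
`ℚ_ℓ`-currency, exactly as `cebotarev_visible_rat_of_not_isSquare` does for Cor. 3.2:

* `two_rays_visible_rat_of_not_isSquare` — on the LINE-6 habitat, UNCONDITIONALLY: `∀ b ∃ ℓ > b`,
  `Frob_ℓ = Frob_∞` on `K(E[q])`, Zhang–Kolyvagin at `2` of level `N`, `M ≤ M(ℓ)`, and at the place
  `v ∋ ℓ` of `ℚ` (`A₁ = torsionLocalKer_v(E)`, `A₂ = torsionLocalKer_v(E^{(d_K)})`): `T ⊆ A₁ × A₂`,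
  `2^j g₁ ∈ A₁ × A₂ ⟺ 2^j g₁ ∈ ⟨T⟩`, `2^j g₂ ∈ A₁ × A₂ ⟺ 2^j g₂ ∈ ⟨T⟩`.

Mechanism: enumerate `(g₁, g₂, T)` as `e : Fin (#T + 2) → V₁ × V₂`; descend by
`D(u, y) = res u + hPsiKT (res y)` (`σ₀`-eigenclasses, `EigenClassesFinite`); injectivity of `rK` on the
span gives `hvis` and turns `D(2^j g_k) ∈ D⟨T⟩` back into `2^j g_k ∈ ⟨T⟩`; the local statements come
back to `ℚ_ℓ` through the Kolyvagin-prime dictionary for `E` and for the twin (`…KolyvaginPrimeDictionary`,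
`…TwinGrossPrimes`, `…TwistLocalConditions`, seat gk2-p3). Helper (`--supports` 22137), closes nothing;
THEOREMS ONLY, 0 sorry, standard axioms, no named fact. BSD is not proved by this.

References: [McCallumLMS1991] §3 Prop. 3.1 with (2)–(3), §5 (21)–(23); [GrossLMS1991] §9;
[Kolyvagin1989Izv] §3.
-/

set_option autoImplicit false
set_option linter.dupNamespace false -- tree convention: `Summit.BirchSwinnertonDyer.BirchSwinnertonDyer.Theorems` (summit = sub-problem)

noncomputable section

open scoped Classical

namespace Summit.BirchSwinnertonDyer.BirchSwinnertonDyer.Theorems.GenusExact.SelmerDescent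

open WeierstrassCurve NumberField IsDedekindDomain Field Finset
open Literature.NumberTheory.EllipticCurves Literature.NumberTheory.GaloisRepresentations
open Summit.BirchSwinnertonDyer.BirchSwinnertonDyer.Theorems.GenusExact.EigenClassesFinite
open Summit.BirchSwinnertonDyer.BirchSwinnertonDyer.Theorems.GenusExact.TwinGrossPrimes
open Summit.BirchSwinnertonDyer.BirchSwinnertonDyer.Theorems.GenusExact.VisiblePairAtTwo

variable {K : Type} [Field K] [NumberField K]

/-- **McCallum's Prop. 3.1 in kernel form at `p = 2`, two rays, for the `ℚ`-pair `(E, E^{(d_K)})`,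
`ℚ_ℓ`-currency** — the hypothesis `hCeb` of `VisiblePairHypothesesM.sel₁_eq_and_card_sel₂_eq_of_primitive`
for the LINE-6 instance. Data as in `cebotarev_visible_rat_of_not_isSquare`; `T` a finite set of PURE
classes of `H¹(ℚ, E[q]) × H¹(ℚ, E^{(d_K)}[q])`, `g₁, g₂` pure classes, and `rK` injective on the span of
`{g₁, g₂} ∪ T` (`hvis`: a class of the span whose descended class `res u + hPsiKT (res y)` pairs
trivially with `Γ_{K(E[q])}` is zero). Conclusion: for every `b` there is `ℓ > b`, `Frob_ℓ = Frob_∞` on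
`K(E[q])`, `ℓ` Zhang–Kolyvagin at `2` of level `N`, `M ≤ M(ℓ)`, such that at the place `v ∋ ℓ` of `ℚ`:
every `t ∈ T` lies in `torsionLocalKer_v(E) × torsionLocalKer_v(E^{(d_K)})`, and for `k = 1, 2` and
all `j`: `2^j g_k ∈ torsionLocalKer_v(E) × torsionLocalKer_v(E^{(d_K)}) ⟺ 2^j g_k ∈ ⟨T⟩`.
[cite: McCallumLMS1991, Prop. 3.1 with §3 (2)–(3); §5 (21)–(23)] [cite: GrossLMS1991, §9]
[cite: Kolyvagin1989Izv, §3] -/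
theorem two_rays_visible_rat_of_not_isSquare
    (N : ℕ) [NeZero N] (W : WeierstrassCurve ℚ) [W.IsElliptic] [W.IsGloballyMinimal]
    (hN : W.conductorNorm ℤ ∣ N) (hcm : ¬ W.HasCM) (hΔ : W.Δ < 0) (K : Type) [Field K] [NumberField K]
    (hK : IsImaginaryQuadratic K) (hodd : Odd (NumberField.discr K))
    (hns : ¬ IsSquare ((NumberField.discr K : ℚ) * -|W.Δ|))
    (hρ : ∀ n : ℕ, W.HasSurjectiveModNGaloisRep (2 ^ n : ℕ))
    {θ : K} (hθ : θ ∉ Set.range (algebraMap ℚ K))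
    (hc : θ ^ 2 = algebraMap ℚ K ((NumberField.discr K : ℤ) : ℚ))
    [(W.quadraticTwist ((NumberField.discr K : ℤ) : ℚ)).IsElliptic]
    (M : ℕ) (hM : 1 ≤ M) {q : ℕ} (hq : q = 2 ^ M)
    (T : Finset (galH1Torsion W (q : ℤ) ×
      galH1Torsion (W.quadraticTwist ((NumberField.discr K : ℤ) : ℚ)) (q : ℤ)))
    (g₁ g₂ : galH1Torsion W (q : ℤ) ×
      galH1Torsion (W.quadraticTwist ((NumberField.discr K : ℤ) : ℚ)) (q : ℤ))
    (hg₁ : g₁.2 = 0 ∨ g₁.1 = 0) (hg₂ : g₂.2 = 0 ∨ g₂.1 = 0) (hT : ∀ t ∈ T, t.2 = 0 ∨ t.1 = 0)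
    (hvis : ∀ g ∈ AddSubgroup.closure (insert g₁ (insert g₂ (T : Set _))),
      (∀ ρ ∈ torsionFixing (W.baseChange K) (q : ℤ),
        h1Eval (W.baseChange K) (q : ℤ) (resTorsion W K (q : ℤ) g.1 + hPsiKT W K hθ hc (q : ℤ)
          (resTorsion (W.quadraticTwist ((NumberField.discr K : ℤ) : ℚ)) K (q : ℤ) g.2)) ρ = 0) →
      g = 0)
    (b : ℕ) :
    ∃ ℓ : ℕ, b < ℓ ∧ FrobEqFrobInfty W K q ℓ ∧ Zhang2014.IsKolyvaginPrime N W K 2 ℓ ∧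
      M ≤ Zhang2014.kolyvaginIndex W 2 ℓ ∧
      ∀ v : HeightOneSpectrum (𝓞 ℚ), (ℓ : 𝓞 ℚ) ∈ v.asIdeal →
        (∀ t ∈ T, t ∈ (W.torsionLocalKer (v.adicCompletion ℚ) (q : ℤ)).prod
          ((W.quadraticTwist ((NumberField.discr K : ℤ) : ℚ)).torsionLocalKer
            (v.adicCompletion ℚ) (q : ℤ))) ∧
        (∀ j : ℕ, ((2 : ℤ) ^ j) • g₁ ∈ (W.torsionLocalKer (v.adicCompletion ℚ) (q : ℤ)).prod
            ((W.quadraticTwist ((NumberField.discr K : ℤ) : ℚ)).torsionLocalKer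
              (v.adicCompletion ℚ) (q : ℤ)) ↔
          ((2 : ℤ) ^ j) • g₁ ∈ AddSubgroup.closure (T : Set _)) ∧
        (∀ j : ℕ, ((2 : ℤ) ^ j) • g₂ ∈ (W.torsionLocalKer (v.adicCompletion ℚ) (q : ℤ)).prod
            ((W.quadraticTwist ((NumberField.discr K : ℤ) : ℚ)).torsionLocalKer
              (v.adicCompletion ℚ) (q : ℤ)) ↔
          ((2 : ℤ) ^ j) • g₂ ∈ AddSubgroup.closure (T : Set _)) := by
  classical
  subst hq
  haveI : Fact (Nat.Prime 2) := ⟨Nat.prime_two⟩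
  have h2K : Module.finrank ℚ K = 2 := hK.1
  have hd0 : ((NumberField.discr K : ℤ) : ℚ) ≠ 0 := by exact_mod_cast NumberField.discr_ne_zero K
  have hL := forall_zsmul_two_pow_baseChange_eq_zero_of_hasSurjectiveModNGaloisRep_two W K h2K
    (by simpa using hρ 1) M
  -- ### the descent map `D (u, y) = res u + hPsiKT (res y)`
  set D : galH1Torsion W ((2 ^ M : ℕ) : ℤ) ×
      galH1Torsion (W.quadraticTwist ((NumberField.discr K : ℤ) : ℚ)) ((2 ^ M : ℕ) : ℤ) →+
      galH1Torsion (W.baseChange K) ((2 ^ M : ℕ) : ℤ) :=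
    (resTorsion W K ((2 ^ M : ℕ) : ℤ)).coprod
      ((hPsiKT W K hθ hc ((2 ^ M : ℕ) : ℤ)).toAddMonoidHom.comp
        (resTorsion (W.quadraticTwist ((NumberField.discr K : ℤ) : ℚ)) K ((2 ^ M : ℕ) : ℤ)))
    with hD_def
  have hD : ∀ g, D g = resTorsion W K ((2 ^ M : ℕ) : ℤ) g.1 + hPsiKT W K hθ hc ((2 ^ M : ℕ) : ℤ)
      (resTorsion (W.quadraticTwist ((NumberField.discr K : ℤ) : ℚ)) K ((2 ^ M : ℕ) : ℤ) g.2) :=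
    fun g ↦ by simp only [hD_def, AddMonoidHom.coprod_apply, AddMonoidHom.coe_comp,
      AddEquiv.coe_toAddMonoidHom, Function.comp_apply]
  -- the span and `hvis` read through `D`
  set S : Set (galH1Torsion W ((2 ^ M : ℕ) : ℤ) ×
      galH1Torsion (W.quadraticTwist ((NumberField.discr K : ℤ) : ℚ)) ((2 ^ M : ℕ) : ℤ)) :=
    insert g₁ (insert g₂ (T : Set _)) with hS_def
  have hvisD : ∀ g ∈ AddSubgroup.closure S, D g = 0 → g = 0 := fun g hg h0 ↦
    hvis g hg fun ρ hρ ↦ by rw [← hD, h0, h1Eval_zero _ _ hρ]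
  have hTS : AddSubgroup.closure (T : Set _) ≤ AddSubgroup.closure S :=
    AddSubgroup.closure_mono (fun t ht ↦ Set.mem_insert_of_mem _ (Set.mem_insert_of_mem _ ht))
  -- ### the enumeration `e = (g₁, g₂, T)` of `{g₁, g₂} ∪ T` by `Fin (#T + 2)`
  set n := T.card with hn
  set e : Fin (n + 2) → galH1Torsion W ((2 ^ M : ℕ) : ℤ) ×
      galH1Torsion (W.quadraticTwist ((NumberField.discr K : ℤ) : ℚ)) ((2 ^ M : ℕ) : ℤ) :=
    Fin.cons g₁ (Fin.cons g₂ fun k ↦ ((T.equivFin.symm k : T) : _)) with he_def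
  have he0 : e 0 = g₁ := by simp only [he_def, Fin.cons_zero]
  have he1 : e 1 = g₂ := by
    rw [← Fin.succ_zero_eq_one]; simp only [he_def, Fin.cons_succ, Fin.cons_zero]
  have hess : ∀ k : Fin n, e k.succ.succ = ((T.equivFin.symm k : T) : _) := fun k ↦ by
    simp only [he_def, Fin.cons_succ]
  have hess_mem : ∀ k : Fin n, e k.succ.succ ∈ T := fun k ↦ by rw [hess]; exact (T.equivFin.symm k).2
  have hss_ne0 : ∀ k : Fin n, k.succ.succ ≠ 0 := fun k ↦ Fin.succ_ne_zero _
  have hss_ne1 : ∀ k : Fin n, k.succ.succ ≠ 1 := fun k h ↦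
    Fin.succ_ne_zero k (Fin.succ_injective _ (h.trans Fin.succ_zero_eq_one.symm))
  -- every `e i` is in `S` and is pure
  have he_mem : ∀ i, e i ∈ S := by
    intro i
    rcases Fin.eq_zero_or_eq_succ i with rfl | ⟨j, rfl⟩
    · rw [he0]; exact Set.mem_insert _ _
    · rcases Fin.eq_zero_or_eq_succ j with rfl | ⟨k, rfl⟩
      · rw [Fin.succ_zero_eq_one, he1]
        exact Set.mem_insert_of_mem _ (Set.mem_insert _ _)
      · exact Set.mem_insert_of_mem _ (Set.mem_insert_of_mem _ (hess_mem k))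
  have he_pure : ∀ i, (e i).2 = 0 ∨ (e i).1 = 0 := by
    intro i
    rcases Fin.eq_zero_or_eq_succ i with rfl | ⟨j, rfl⟩
    · rw [he0]; exact hg₁
    · rcases Fin.eq_zero_or_eq_succ j with rfl | ⟨k, rfl⟩
      · rw [Fin.succ_zero_eq_one, he1]; exact hg₂
      · exact hT _ (hess_mem k)
  -- the indices `≠ 0, 1` enumerate `T`
  have himage : (fun i ↦ D (e i)) '' {i | i ≠ (0 : Fin (n + 2)) ∧ i ≠ 1} = D '' (T : Set _) := by
    ext y
    constructor
    · rintro ⟨i, ⟨hi0, hi1⟩, rfl⟩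
      rcases Fin.eq_zero_or_eq_succ i with rfl | ⟨j, rfl⟩
      · exact absurd rfl hi0
      · rcases Fin.eq_zero_or_eq_succ j with rfl | ⟨k, rfl⟩
        · exact absurd Fin.succ_zero_eq_one hi1
        · exact ⟨_, hess_mem k, rfl⟩
    · rintro ⟨t, ht, rfl⟩
      refine ⟨(T.equivFin ⟨t, ht⟩).succ.succ, ⟨hss_ne0 _, hss_ne1 _⟩, ?_⟩
      simp only [hess, Equiv.symm_apply_apply]
  -- ### the descended family, its signs, `hvis`
  set gens : Fin (n + 2) → galH1Torsion (W.baseChange K) ((2 ^ M : ℕ) : ℤ) := fun i ↦ D (e i)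
    with hgens
  set sgn : Fin (n + 2) → ℤ := fun i ↦ if (e i).2 = 0 then 1 else -1 with hsgn_def
  have hsgn : ∀ i, sgn i = 1 ∨ sgn i = -1 := fun i ↦ by
    simp only [hsgn_def]
    split_ifs
    · exact Or.inl rfl
    · exact Or.inr rfl
  have hτs : ∀ i, conjAct W (sigmaQ K h2K hθ hc) ((2 ^ M : ℕ) : ℤ) (gens i) = sgn i • gens i := by
    intro i
    by_cases h2 : (e i).2 = 0
    · have hsg : sgn i = 1 := if_pos h2
      have hgi : gens i = resTorsion W K ((2 ^ M : ℕ) : ℤ) (e i).1 := by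
        simp only [hgens, hD, h2, map_zero, add_zero]
      rw [hsg, one_zsmul, hgi]
      exact (mem_range_resTorsion_iff_conjAct_eq W K h2K hθ hc _ hL _).mp ⟨_, rfl⟩
    · have h1 : (e i).1 = 0 := (he_pure i).resolve_left h2
      have hsg : sgn i = -1 := if_neg h2
      have hgi : gens i = hPsiKT W K hθ hc ((2 ^ M : ℕ) : ℤ)
          (resTorsion (W.quadraticTwist ((NumberField.discr K : ℤ) : ℚ)) K ((2 ^ M : ℕ) : ℤ)
            (e i).2) := by
        simp only [hgens, hD, h1, map_zero, zero_add]
      rw [hsg, neg_one_zsmul, hgi]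
      exact (exists_hPsiKT_resTorsion_eq_iff_conjAct_eq_neg W K h2K hθ hc _ hL _).mp ⟨_, rfl⟩
  have hvisK : ∀ a : Fin (n + 2) → ℤ, (∀ ρ ∈ torsionFixing (W.baseChange K) ((2 ^ M : ℕ) : ℤ),
      h1Eval (W.baseChange K) ((2 ^ M : ℕ) : ℤ) (∑ i, a i • gens i) ρ = 0) →
      ∑ i, a i • gens i = 0 := by
    intro a ha
    have hsum : ∑ i, a i • gens i = D (∑ i, a i • e i) := by
      rw [map_sum]
      exact Finset.sum_congr rfl fun i _ ↦ by rw [map_zsmul]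
    have hmem : ∑ i, a i • e i ∈ AddSubgroup.closure S :=
      AddSubgroup.sum_mem _ fun i _ ↦
        AddSubgroup.zsmul_mem _ (AddSubgroup.subset_closure (he_mem i)) _
    have h0 : ∑ i, a i • e i = 0 :=
      hvis _ hmem fun ρ hρ ↦ by rw [← hD, ← hsum]; exact ha ρ hρ
    rw [hsum, h0, map_zero]
  -- ### the `K_λ`-currency theorem on the two rays `0, 1`
  have hσ : sigmaQ K h2K hθ hc ≠ 1 := sigmaQ_ne_one K h2K hθ hc
  obtain ⟨ℓ, hbℓ, hFrob, hKol, hidx, hoff, hrays⟩ :=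
    exists_kolyvaginPrime_two_rays_of_not_isSquare N W hcm hΔ K hK hns hρ (sigmaQ K h2K hθ hc) hσ
      M hM gens sgn hsgn hτs hvisK 0 1 b
  refine ⟨ℓ, hbℓ, hFrob, hKol, hidx, fun v hℓv ↦ ?_⟩
  -- ### bookkeeping at `ℓ`
  have hℓ : ℓ.Prime := hKol.1
  have hℓ2 : ℓ ≠ 2 := hKol.2.2.2.1
  have hℓN : ¬ ℓ ∣ W.conductorNorm ℤ := fun h ↦ hKol.2.1 (h.trans hN)
  have hℓd : ¬ ((ℓ : ℤ) ∣ NumberField.discr K) := hKol.2.2.1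
  have hprime : (Ideal.span {(ℓ : 𝓞 K)}).IsPrime := hKol.2.2.2.2.1
  haveI : Fact ℓ.Prime := ⟨hℓ⟩
  have hgoodℓ : W.HasGoodReductionAtPrime ℓ := hasGoodReductionAtPrime_of_not_dvd_conductorNorm W hℓN
  have hgood : W.HasGoodReductionAt v := hasGoodReductionAt_of_hasGoodReductionAtPrime W hgoodℓ hℓv
  have h1C : (1 : VariableChange ℚ) • W.quadraticTwist ((NumberField.discr K : ℤ) : ℚ) =
      W.quadraticTwist ((NumberField.discr K : ℤ) : ℚ) := one_smul _ _
  have hgoodℓ' : (W.quadraticTwist ((NumberField.discr K : ℤ) : ℚ)).HasGoodReductionAtPrime ℓ :=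
    hasGoodReductionAtPrime_of_smul_quadraticTwist_eq W h2K hodd _ h1C hℓd hgoodℓ
  have hgood' : (W.quadraticTwist ((NumberField.discr K : ℤ) : ℚ)).HasGoodReductionAt v :=
    hasGoodReductionAt_of_hasGoodReductionAtPrime _ hgoodℓ' hℓv
  have hΔ' : (W.quadraticTwist ((NumberField.discr K : ℤ) : ℚ)).Δ < 0 :=
    Δ_neg_of_smul_quadraticTwist_eq W hd0 _ h1C hΔ
  have hFrob' : FrobEqFrobInfty (W.quadraticTwist ((NumberField.discr K : ℤ) : ℚ)) K (2 ^ M) ℓ :=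
    frobEqFrobInfty_of_smul_quadraticTwist_eq W hK _ h1C hFrob
  obtain ⟨w, hℓw⟩ := exists_natCast_mem (K := K) hℓ
  have hf := inertiaDeg_eq_two_of_span_isPrime h2K hℓ hprime hℓv hℓw
  haveI : w.asIdeal.LiesOver v.asIdeal := liesOver_of_natCast_mem hℓ hℓv hℓw
  have hθ' : θ ∉ (algebraMap ℚ K).range := by rwa [RingHom.mem_range, ← Set.mem_range]
  have hcv : (((NumberField.discr K : ℤ) : ℤ) : 𝓞 ℚ) ∉ v.asIdeal := intCast_notMem_of_not_dvd hℓ hℓv hℓd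
  -- ### transfer of the strict condition for a pure class: `c'·t ∈ A₁ × A₂ ↔ c'·D t ∈ A_w`
  have htransfer : ∀ t : galH1Torsion W ((2 ^ M : ℕ) : ℤ) ×
      galH1Torsion (W.quadraticTwist ((NumberField.discr K : ℤ) : ℚ)) ((2 ^ M : ℕ) : ℤ),
      (t.2 = 0 ∨ t.1 = 0) → ∀ c' : ℤ,
      (c' • t ∈ (W.torsionLocalKer (v.adicCompletion ℚ) ((2 ^ M : ℕ) : ℤ)).prod
          ((W.quadraticTwist ((NumberField.discr K : ℤ) : ℚ)).torsionLocalKer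
            (v.adicCompletion ℚ) ((2 ^ M : ℕ) : ℤ)) ↔
        c' • D t ∈ (W.baseChange K).torsionLocalKer (w.adicCompletion K) ((2 ^ M : ℕ) : ℤ)) := by
    intro t ht c'
    rw [AddSubgroup.mem_prod, Prod.smul_fst, Prod.smul_snd]
    rcases ht with h2 | h1
    · have hDt : D t = resTorsion W K ((2 ^ M : ℕ) : ℤ) t.1 := by
        rw [hD, h2, map_zero, map_zero, add_zero]
      rw [h2, zsmul_zero, hDt]
      simp only [AddSubgroup.zero_mem, and_true]
      exact zsmul_mem_torsionLocalKer_iff_resTorsion_of_notMem W hΔ hM rfl hℓ hℓ2 hℓv hgood h2K hθ'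
        hc hcv hFrob w hf t.1 c'
    · have hDt : D t = hPsiKT W K hθ hc ((2 ^ M : ℕ) : ℤ)
          (resTorsion (W.quadraticTwist ((NumberField.discr K : ℤ) : ℚ)) K ((2 ^ M : ℕ) : ℤ) t.2) := by
        rw [hD, h1, map_zero, zero_add]
      rw [h1, zsmul_zero, hDt]
      simp only [AddSubgroup.zero_mem, true_and]
      rw [zsmul_mem_torsionLocalKer_iff_resTorsion_of_notMem (W.quadraticTwist _) hΔ' hM rfl hℓ hℓ2
        hℓv hgood' h2K hθ' hc hcv hFrob' w hf t.2 c',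
        zsmul_mem_torsionLocalKer_iff_hPsiKT_mem W K hθ hc _ (w.adicCompletion K) _ c']
  -- ### the image span: `⟨D(e i) : i ≠ 0, 1⟩ = D⟨T⟩`
  have hspan : AddSubgroup.closure (gens '' {i | i ≠ (0 : Fin (n + 2)) ∧ i ≠ 1}) =
      (AddSubgroup.closure (T : Set _)).map D := by
    rw [hgens, himage, AddMonoidHom.map_closure]
  -- ### the rays: `2^j·D g ∈ D⟨T⟩ ↔ 2^j·g ∈ ⟨T⟩` by injectivity of `D` on the span
  have hray : ∀ g, g ∈ S → ∀ j : ℕ,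
      (((2 : ℤ) ^ j) • D g ∈ (AddSubgroup.closure (T : Set _)).map D ↔
        ((2 : ℤ) ^ j) • g ∈ AddSubgroup.closure (T : Set _)) := by
    intro g hg j
    constructor
    · intro hmem
      obtain ⟨t, ht, hDt⟩ := AddSubgroup.mem_map.mp hmem
      have hx : ((2 : ℤ) ^ j) • g - t ∈ AddSubgroup.closure S :=
        AddSubgroup.sub_mem _ (AddSubgroup.zsmul_mem _ (AddSubgroup.subset_closure hg) _) (hTS ht)
      have h0 : ((2 : ℤ) ^ j) • g - t = 0 :=
        hvisD _ hx (by rw [map_sub, map_zsmul, hDt, sub_self])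
      rw [sub_eq_zero] at h0
      rw [h0]; exact ht
    · intro hmem
      rw [← map_zsmul]
      exact AddSubgroup.mem_map_of_mem D hmem
  -- ### assembly
  refine ⟨fun t ht ↦ ?_, fun j ↦ ?_, fun j ↦ ?_⟩
  · -- `t ∈ T` is off the two rays: `D t ∈ A_w`
    set k := T.equivFin ⟨t, ht⟩ with hk
    have het : e k.succ.succ = t := by rw [hess, hk, Equiv.symm_apply_apply]
    have h := hoff k.succ.succ (hss_ne0 k) (hss_ne1 k) w hℓw
    change D (e k.succ.succ) ∈ _ at h
    rw [het] at h
    have h' := (htransfer t (hT t ht) 1).mpr (by rw [one_zsmul]; exact h)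
    rwa [one_zsmul] at h'
  · rw [htransfer g₁ hg₁, ← hray g₁ (Set.mem_insert _ _) j, ← hspan]
    have h := hrays 0 (Or.inl rfl) w hℓw j
    rw [show gens 0 = D g₁ by simp only [hgens, he0]] at h
    exact h
  · rw [htransfer g₂ hg₂, ← hray g₂ (Set.mem_insert_of_mem _ (Set.mem_insert _ _)) j, ← hspan]
    have h := hrays 1 (Or.inr rfl) w hℓw j
    rw [show gens 1 = D g₂ by simp only [hgens, he1]] at h
    exact h

end Summit.BirchSwinnertonDyer.BirchSwinnertonDyer.Theorems.GenusExact.SelmerDescent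

end
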